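import Summits.CriticalPhenomena.PercolationContinuityZ3.Theorems.Transplant.SkelFrmBParamsFineSize
import Summits.CriticalPhenomena.PercolationContinuityZ3.Theorems.Transplant.SkelNegBParamsFineSize
import Summits.CriticalPhenomena.PercolationContinuityZ3.Theorems.Transplant.SkelNegBChoiceAll
import Summits.CriticalPhenomena.PercolationContinuityZ3.Theorems.Transplant.TwoAxisParaCellsFineFrame
import Summits.CriticalPhenomena.PercolationContinuityZ3.Theorems.Transplant.SkelFrm1SlotTypes
import Summits.CriticalPhenomena.PercolationContinuityZ3.Theorems.Transplant.SkelFrm1ParamsPO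
import Summits.CriticalPhenomena.PercolationContinuityZ3.Theorems.Transplant.SkelFrm1ParamsLBL
import Summits.CriticalPhenomena.PercolationContinuityZ3.Theorems.Transplant.SkelFrm1ParamsLF
import Summits.CriticalPhenomena.PercolationContinuityZ3.Theorems.Transplant.SkelFrm1ParamsLO
import Summits.CriticalPhenomena.PercolationContinuityZ3.Theorems.Transplant.SkelFrmBParamsLF
import Summits.CriticalPhenomena.PercolationContinuityZ3.Theorems.Transplant.SkelFrmBParamsLO
import Summits.CriticalPhenomena.PercolationContinuityZ3.Theorems.Transplant.SkelNegBParamsSched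
import Summits.CriticalPhenomena.PercolationContinuityZ3.Theorems.Transplant.PlanarSkeletonFrmDefs
import Summits.CriticalPhenomena.PercolationContinuityZ3.Theorems.Transplant.SkelPhiStepIDataNS
import HarnessLib

-- stmt-g19 WAVE-1 source surgery: rep₂_cen_at / Nrep_cen_le / offN_le / hoffN_at REMOVED from this copy (Geom re-base: `cen ↦ cenS`, `offN` home) — they port with the Geom wave

/-!
# N2 (frames-only node `SamePDropOfSkeletonFrm₁`, OPEN) params column over `PlanarSkeletonFrm` — (ζ″) ledger, shape (B′) of record ((R-14)):
# MECHANICAL PORT of N1's `SkelNegBParamsSched` — chain of record `NegB`, part S (schedule side): THE LATTICE RECORD `NegB.prF : FinePrm` OF THE CELLS OF RECORD (`⟨800,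
# n_L, h_L, v_L, v_β, 20K·s₀, 20K·s₁, D⟩`, `prF.ψ φ′ t = NegB.fine … φ′` by `rfl`), THE CANONICAL REPRESENTATIVE AT A CELL CENTRE IS EXACT (`rep₂ (cen x) = (800(x₀n +
# x₁v_α), 800(x₀h … (N1 title abridged; see `SkelNegBParamsSched`)
builds on p205010 (kernel theorem, internal audit signed; external expert review pending) — nothing in this file uses p205010; NOTHING is claimed about the
open node `SamePDropOfSkeletonFrm₁` (`SamePDropOfSkeletonNeg₁` is CLOSED in the tree and untouched by this file).
Status sentence (coordinator 2026-08-20T04:30Z): "θ(p_c) = 0 on ℤ^d, all d ≥ 2 — kernel-verified (Lean 4/Mathlib, standard axioms); internal adversarial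
audit SIGNED 2026-08-20 04:29Z; external expert review pending."
Lane `prim-bschramm-*`, seat `prim-bschramm-stmt` (gen 19); helper file (`--supports stmt-CriticalPhenomena-4575 --as helper`); ledger HOME/prim-bschramm-stmt/FRM-PARAMS.md §9, (R-14).
PORT RULES (HOME/prim-bschramm-stmt-g19/lean/port_frm.py, the tool of record per (R-14)): outer namespace `PlanarSkeletonNeg ↦ PlanarSkeletonFrm`, carrier binder
`(Φ : PlanarSkeletonFrm G)`, record binder `(D : Skelφ.StepI.DataNS V)` (the selectors travel IN the record, `SkelPhiStepIDataNS`); section variables INLINED into every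
declaration header; inner namespaces (`Neg`/`NegB`/`KS`/…) and every short name KEPT so all cross-references resolve unchanged; declarations using no section variable are
NOT re-declared (N1's originals are referenced fully qualified). Mathematical content, proofs, docstrings and citations are N1's, verbatim, except where stated next.
SELECTORS IN THIS FILE ((R-14) condition of record — joint selection, `D.sN`'s first argument is the literal handed to `D.sM`): none (pure port; the pairs are read through their N1 names).
N1 HEADER (kept for the reader):
helper file (`--supports stmt-CriticalPhenomena-4575 --as helper`); ledger HOME/prim-bschramm-stmt/NEG-PARAMS.md v0.10;
hp-8 g33 2026-08-21T15:4xZ/16:0xZ (the (F) schedule binders `hoff : ∀ x, off x ≤ c·(|x₀|+|x₁|) + 1`, `hoffN : ‖rep₂ pr… (P.cen x)‖₁ + 1 ≤ off x` of `faceOblRM_fineN`, `S.rmax := max P.rmax (c+1)`).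
* §1 `TwoAxis.Para.rdiv_mul_left` (`rdiv (d·X) d = X`), **`TwoAxis.Para.rep₂_of_mul`** (`z_i = c_i·v_i ⇒ rep₂ z = (A(v₀n + v₁v_α), A(v₀h + v₁v_β))`), `PCells2.cen_eq_mul` (`cen v i = (20·K·s_i)·v_i`);
* §2 **`NegB.prF`** (+ `prF_fields`, **`prF_ψ`**: `prF.ψ φ′ t = NegB.fine … φ′`, `prF_c`), **`NegB.cOff`**, `rep₂_cen_at`, `Nrep_cen_le` (`Nrep (cen x) ≤ 800(L̂₁|x₀| + L̂₀|x₁|)`),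
  **`offN_le`** (`offN x ≤ cOff·(|x₀|+|x₁|) + 1` under `EqNumL` + `|h_L| ≤ 10 n_L`), **`hoffN_at`**.
[cite: KozmaNitzan2024, §4 pp. 25–26; Lemma 12 (p. 24)] [cite: MartineauTassion2017, §4.3]
-/

noncomputable section

open scoped Classical

namespace Summit.CriticalPhenomena.PercolationContinuityZ3.Theorems.Transplant

open Literature.Probability.LatticeModels

/-! ## §1 The representative at an exact multiple -/

namespace TwoAxis.Para

end TwoAxis.Para

namespace PlanarSkeletonFrm

namespace NegB

open SkelConc (Consts)
open Neg

section Sched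

/-! ## §2 The lattice record of the cells of record and the linear column bound -/

/-- **THE LATTICE RECORD OF RECORD** `prF := ⟨800, n_L, h_L, v_L, v_β, 20K·s₀, 20K·s₁, D⟩` (hp-8's `FinePrm`; `prF.ψ φ′ t = NegB.fine … φ′`). [this work] -/
def prF (κ : Consts) {V : Type} [DecidableEq V] [Countable V] {G : SimpleGraph V} [G.LocallyFinite] (Φ : PlanarSkeletonFrm G) (t : V) (p : unitInterval) (D : Skelφ.StepI.DataNS V) (g : ℕ) (f : ℕ) : Skelφ.FinePrm where
  A := 800
  n := nL κ Φ t p D g f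
  h := hL κ Φ t p D g f
  vα := vL κ Φ t p D g f
  vβ := vβL κ Φ t p D g f
  c₀ := 20 * ((fcells κ Φ t p D g f).K : ℤ) * (((fcells κ Φ t p D g f).s 0 : ℕ) : ℤ)
  c₁ := 20 * ((fcells κ Φ t p D g f).K : ℤ) * (((fcells κ Φ t p D g f).s 1 : ℕ) : ℤ)
  D := Skelφ.NegPrm.Dof (nL κ Φ t p D g f) (hL κ Φ t p D g f) (ℓL κ Φ t p D g f) (vL κ Φ t p D g f)

/-- The fields of `prF` by `rfl`. [folklore] -/
theorem prF_fields (κ : Consts) {V : Type} [DecidableEq V] [Countable V] {G : SimpleGraph V} [G.LocallyFinite] (Φ : PlanarSkeletonFrm G) (t : V) (p : unitInterval) (D : Skelφ.StepI.DataNS V) (g : ℕ) (f : ℕ) :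
    (prF κ Φ t p D g f).A = 800 ∧ (prF κ Φ t p D g f).n = nL κ Φ t p D g f ∧ (prF κ Φ t p D g f).h = hL κ Φ t p D g f ∧
      (prF κ Φ t p D g f).vα = vL κ Φ t p D g f ∧ (prF κ Φ t p D g f).vβ = vβL κ Φ t p D g f ∧
      (prF κ Φ t p D g f).c₀ = 20 * ((fcells κ Φ t p D g f).K : ℤ) * (((fcells κ Φ t p D g f).s 0 : ℕ) : ℤ) ∧
      (prF κ Φ t p D g f).c₁ = 20 * ((fcells κ Φ t p D g f).K : ℤ) * (((fcells κ Φ t p D g f).s 1 : ℕ) : ℤ) ∧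
      (prF κ Φ t p D g f).D = Skelφ.NegPrm.Dof (nL κ Φ t p D g f) (hL κ Φ t p D g f) (ℓL κ Φ t p D g f) (vL κ Φ t p D g f) :=
  ⟨rfl, rfl, rfl, rfl, rfl, rfl, rfl, rfl⟩

/-- **`prF.ψ φ′ t = NegB.fine … φ′`** (the (F) files' cell map IS the fine window map of record). [folklore] -/
theorem prF_ψ (κ : Consts) {V : Type} [DecidableEq V] [Countable V] {G : SimpleGraph V} [G.LocallyFinite] (Φ : PlanarSkeletonFrm G) (t : V) (p : unitInterval) (D : Skelφ.StepI.DataNS V) (g : ℕ) (f : ℕ) (φ' : V → Site 2) : (prF κ Φ t p D g f).ψ φ' t = fine κ Φ t p D g f φ' := rfl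

/-- `prF.D = detD prF.A prF.n prF.h prF.vα prF.vβ` (the determinant slot is the true determinant). [folklore] -/
theorem prF_D (κ : Consts) {V : Type} [DecidableEq V] [Countable V] {G : SimpleGraph V} [G.LocallyFinite] (Φ : PlanarSkeletonFrm G) (t : V) (p : unitInterval) (D : Skelφ.StepI.DataNS V) (g : ℕ) (f : ℕ) : (prF κ Φ t p D g f).D = TwoAxis.Para.detD (prF κ Φ t p D g f).A (prF κ Φ t p D g f).n (prF κ Φ t p D g f).h (prF κ Φ t p D g f).vα (prF κ Φ t p D g f).vβ :=
  rfl

/-- `0 < prF.c₀`, `0 < prF.c₁`. [folklore] -/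
theorem prF_c_pos (κ : Consts) {V : Type} [DecidableEq V] [Countable V] {G : SimpleGraph V} [G.LocallyFinite] (Φ : PlanarSkeletonFrm G) (t : V) (p : unitInterval) (D : Skelφ.StepI.DataNS V) (g : ℕ) (f : ℕ) : 0 < (prF κ Φ t p D g f).c₀ ∧ 0 < (prF κ Φ t p D g f).c₁ := ⟨c_pos κ Φ t p D g f 0, c_pos κ Φ t p D g f 1⟩

/-- **THE COLUMN CONSTANT OF RECORD** `cOff := 800·(ℓ_L + 21·n_L + 1)` (`≥ 800·max(L̂₀, L̂₁)`). [this work] -/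
def cOff (κ : Consts) {V : Type} [DecidableEq V] [Countable V] {G : SimpleGraph V} [G.LocallyFinite] (Φ : PlanarSkeletonFrm G) (t : V) (p : unitInterval) (D : Skelφ.StepI.DataNS V) (g : ℕ) (f : ℕ) : ℕ := 800 * (ℓL κ Φ t p D g f + 21 * nL κ Φ t p D g f + 1)

/-- **The (F) binders `hL0/hL1` at the record** (`c₀·L 0 + 2 ≤ D`, `c₁·L 1 + 2 ≤ D` in `FinePrm`'s vocabulary) from `room_fcells_at`. [folklore] -/
theorem prF_room (κ : Consts) {V : Type} [DecidableEq V] [Countable V] {G : SimpleGraph V} [G.LocallyFinite] (Φ : PlanarSkeletonFrm G) (t : V) (p : unitInterval) (D : Skelφ.StepI.DataNS V) (g : ℕ) (f : ℕ) (hN : EqNumL κ Φ t p D g f) :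
    (prF κ Φ t p D g f).c₀ * (prF κ Φ t p D g f).L 0 + 2 ≤ (prF κ Φ t p D g f).D ∧ (prF κ Φ t p D g f).c₁ * (prF κ Φ t p D g f).L 1 + 2 ≤ (prF κ Φ t p D g f).D := by
  obtain ⟨h0, h1⟩ := room_fcells_at κ Φ t p D g f hN
  have e0 : (prF κ Φ t p D g f).L 0 = |(800 : ℤ)| * (|vβL κ Φ t p D g f| + |vL κ Φ t p D g f|) := by
    unfold Skelφ.FinePrm.L Skelφ.FinePrm.lvGen
    simp only [if_true, Matrix.cons_val_zero, Matrix.cons_val_one]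
    rw [add_comm]; rfl
  have e1 : (prF κ Φ t p D g f).L 1 = |(800 : ℤ)| * (|(nL κ Φ t p D g f : ℤ)| + |hL κ Φ t p D g f|) := by
    unfold Skelφ.FinePrm.L Skelφ.FinePrm.lvGen
    simp only [show ((1 : Fin 2) = 0) = False from propext ⟨fun h => absurd h (by decide), False.elim⟩, if_false, Matrix.cons_val_zero, Matrix.cons_val_one]
    rfl
  rw [e0, e1]
  exact ⟨h0, h1⟩

end Sched

end NegB

end PlanarSkeletonFrm

end Summit.CriticalPhenomena.PercolationContinuityZ3.Theorems.Transplant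

end
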